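import Mathlib
import HarnessLib
import Literature.Analysis.PDE.DivFormLiouville
import Summits.NavierStokesRegularity.NavierStokesRegularity.Theorems.PoloidalWindowDoorPoloidalWindowRigidityDivFormCrossover
import Summits.NavierStokesRegularity.NavierStokesRegularity.Theorems.PoloidalWindowDoorPoloidalWindowRigidityDivFormMoserChain

/-!
# Route `PoloidalWindowDoor`, crux K2 (stmt-NavierStokesRegularity-19708) — task H5, step M4a: MOSER'S HARNACK INEQUALITY
# at unit scale for entire solutions of `div(a∇u) = 0`, `n ≥ 3` (towards `divFormLiouville_holds`, De Giorgi–Nash–Moser)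

Seat ns-poloidal-K2-p3 g2 (`ledger fact claim` #1 on `Literature.Analysis.PDE.divFormLiouville`; setting = that fact's
rendering, `w ≥ 1` an entire `C¹` weak solution).  Moser 1961, Thm 1: the sup chain (M3c with `σ = 1`, started from an
exponent `p₁ = κ^{j+½} ≤ p₀` whose chain `p₁κ^k` never meets `1`), the inf chain (`σ = −1`, exponent `p₀`), Hölder on
`B̄(0,2)` and the crossover (M2b, exponent `p₀`) combine to `sup_{B̄(0,1)} w ≤ C_H inf_{B̄(0,1)} w`, `C_H = C_H(n,λ,Λ)`.
General balls follow by scaling (M4b).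

* `enorm_le_eLpNorm_top` — a continuous function is bounded pointwise on `B̄(x₀,R)` by its `L^∞(B̄(x₀,R))` norm;
* `exists_chain_exponent` — `∃ p₁ ∈ (0,p₀]`, `p₁κ^k ≠ 1` and `(p₁κ^k/(p₁κ^k − 1))² ≤ (√κ/(√κ−1))²` for all `k`;
* `harnack_unit` — the displayed Harnack inequality on `B̄(0,1)`.

WHAT THIS IS NOT: not yet the Liouville theorem (M4b scaling ⇒ Liouville for `n ≥ 3`, M4c `n ≤ 2`); nothing NS-specific.
-/

noncomputable section

open MeasureTheory Set Function Filter Topology Metric Module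
open scoped Matrix ENNReal NNReal

-- the summit and its single sub-problem share the name (CONVENTIONS §1), as in every Theorems file
set_option linter.dupNamespace false

namespace Summit.NavierStokesRegularity.NavierStokesRegularity.Theorems.PoloidalWindowDoorPoloidalWindowRigidityDivFormHarnack

open Summit.NavierStokesRegularity.NavierStokesRegularity.Theorems.PoloidalWindowDoorPoloidalWindowRigidityDivFormReverseHolder
open Summit.NavierStokesRegularity.NavierStokesRegularity.Theorems.PoloidalWindowDoorPoloidalWindowRigidityDivFormMoserStep
open Summit.NavierStokesRegularity.NavierStokesRegularity.Theorems.PoloidalWindowDoorPoloidalWindowRigidityDivFormMoserChain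
open Summit.NavierStokesRegularity.NavierStokesRegularity.Theorems.PoloidalWindowDoorPoloidalWindowRigidityDivFormCrossover
open Literature.Analysis.FunctionSpaces

variable {n : ℕ}

/-! ### Pointwise values versus the `L^∞` norm on a closed ball -/

/-- A continuous function is bounded at every point of `B̄(x₀,R)` (`R > 0`) by its `L^∞(B̄(x₀,R))` norm. -/
theorem enorm_le_eLpNorm_top {g : EuclideanSpace ℝ (Fin n) → ℝ} (hg : Continuous g) (x₀ : EuclideanSpace ℝ (Fin n))
    {R : ℝ} (hR : 0 < R) {x : EuclideanSpace ℝ (Fin n)} (hx : x ∈ closedBall x₀ R) :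
    ‖g x‖ₑ ≤ eLpNorm g ∞ (volume.restrict (closedBall x₀ R)) := by
  rw [eLpNorm_exponent_top, eLpNormEssSup_eq_essSup_enorm]
  by_contra hlt
  rw [not_le] at hlt
  set U : Set (EuclideanSpace ℝ (Fin n)) :=
    {y | essSup (fun z => ‖g z‖ₑ) (volume.restrict (closedBall x₀ R)) < ‖g y‖ₑ} with hU
  have hU0 : (volume.restrict (closedBall x₀ R)) U = 0 := meas_essSup_lt
  have hUopen : IsOpen U := isOpen_lt continuous_const hg.enorm
  have hxU : x ∈ U := hlt
  -- `U` meets the open ball: `x ∈ closure (ball x₀ R)`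
  have hxcl : x ∈ closure (ball x₀ R) := by rwa [closure_ball x₀ hR.ne']
  obtain ⟨z, hzU, hzB⟩ : (U ∩ ball x₀ R).Nonempty := mem_closure_iff.1 hxcl U hUopen hxU
  have hpos : 0 < volume (U ∩ ball x₀ R) :=
    (hUopen.inter isOpen_ball).measure_pos volume ⟨z, hzU, hzB⟩
  rw [Measure.restrict_apply' measurableSet_closedBall] at hU0
  have hle : volume (U ∩ ball x₀ R) ≤ volume (U ∩ closedBall x₀ R) :=
    measure_mono (inter_subset_inter_right _ ball_subset_closedBall)
  rw [hU0] at hle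
  exact absurd (le_antisymm hle bot_le) hpos.ne'

/-! ### A chain of exponents avoiding `1` -/

/-- For `κ > 1` and `p₀ > 0` there is `p₁ ∈ (0, p₀]` of the form `κ^{j+½}` (`j ∈ ℤ`); along the chain `p₁κ^k` no exponent
equals `1` and `(t/(t−1))² ≤ (√κ/(√κ−1))²`, `t = p₁κ^k`. -/
theorem exists_chain_exponent {κ : ℝ} (hκ : 1 < κ) {p₀ : ℝ} (hp₀ : 0 < p₀) :
    ∃ p₁ : ℝ, 0 < p₁ ∧ p₁ ≤ p₀ ∧ ∀ k : ℕ, 1 * (p₁ * κ ^ k) ≠ 1 ∧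
      (1 * (p₁ * κ ^ k) / (1 * (p₁ * κ ^ k) - 1)) ^ 2 ≤ (Real.sqrt κ / (Real.sqrt κ - 1)) ^ 2 := by
  have hκ0 : 0 < κ := zero_lt_one.trans hκ
  have hlogκ : 0 < Real.log κ := Real.log_pos hκ
  have hsqκ : 1 < Real.sqrt κ := by
    rw [show (1 : ℝ) = Real.sqrt 1 by simp]
    exact Real.sqrt_lt_sqrt zero_le_one hκ
  set j : ℤ := ⌊Real.log p₀ / Real.log κ - 1 / 2⌋ with hj
  set p₁ : ℝ := κ ^ ((j : ℝ) + 1 / 2) with hp₁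
  have hp₁pos : 0 < p₁ := Real.rpow_pos_of_pos hκ0 _
  refine ⟨p₁, hp₁pos, ?_, fun k => ?_⟩
  · -- `p₁ ≤ p₀`
    have h1 : ((j : ℝ) + 1 / 2) * Real.log κ ≤ Real.log p₀ := by
      have := Int.floor_le (Real.log p₀ / Real.log κ - 1 / 2)
      rw [← hj] at this
      have h' : (j : ℝ) + 1 / 2 ≤ Real.log p₀ / Real.log κ := by linarith
      calc ((j : ℝ) + 1 / 2) * Real.log κ ≤ Real.log p₀ / Real.log κ * Real.log κ :=
            mul_le_mul_of_nonneg_right h' hlogκ.le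
        _ = Real.log p₀ := div_mul_cancel₀ _ hlogκ.ne'
    calc p₁ = Real.exp (((j : ℝ) + 1 / 2) * Real.log κ) := by
          rw [hp₁, Real.rpow_def_of_pos hκ0, mul_comm]
      _ ≤ Real.exp (Real.log p₀) := Real.exp_le_exp.2 h1
      _ = p₀ := Real.exp_log hp₀
  · -- the chain exponent `t = κ^{m + 1/2}`, `m = j + k`
    set t : ℝ := 1 * (p₁ * κ ^ k) with ht
    have htm : t = κ ^ (((j + k : ℤ) : ℝ) + 1 / 2) := by
      rw [ht, one_mul, hp₁, ← Real.rpow_natCast, ← Real.rpow_add hκ0]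
      congr 1; push_cast; ring
    have htpos : 0 < t := by rw [htm]; exact Real.rpow_pos_of_pos hκ0 _
    set D : ℝ := Real.sqrt κ / (Real.sqrt κ - 1) with hD
    have hD1 : 1 ≤ D := by rw [hD, le_div_iff₀ (by linarith)]; linarith
    have hsqrt : Real.sqrt κ = κ ^ (1 / 2 : ℝ) := Real.sqrt_eq_rpow κ
    -- dichotomy on the integer `m = j + k`
    rcases le_or_gt 0 (j + k : ℤ) with hm | hm
    · -- `m ≥ 0`: `t ≥ √κ > 1`
      have hge : Real.sqrt κ ≤ t := by
        rw [htm, hsqrt]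
        refine Real.rpow_le_rpow_of_exponent_le hκ.le ?_
        have : (0 : ℝ) ≤ ((j + k : ℤ) : ℝ) := by exact_mod_cast hm
        linarith
      have ht1 : 1 < t := lt_of_lt_of_le hsqκ hge
      refine ⟨ht1.ne', ?_⟩
      have hq : t / (t - 1) ≤ D := by
        rw [hD, div_le_div_iff₀ (by linarith) (by linarith)]
        nlinarith
      have hq0 : 0 ≤ t / (t - 1) := div_nonneg htpos.le (by linarith)
      exact pow_le_pow_left₀ hq0 hq 2
    · -- `m ≤ -1`: `t ≤ 1/√κ < 1`
      have hle : t ≤ κ ^ (-(1 / 2 : ℝ)) := by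
        rw [htm]
        refine Real.rpow_le_rpow_of_exponent_le hκ.le ?_
        have : ((j + k : ℤ) : ℝ) ≤ -1 := by exact_mod_cast (Int.le_sub_one_iff.2 hm : (j + k : ℤ) ≤ 0 - 1)
        linarith
      have hinv : κ ^ (-(1 / 2 : ℝ)) = (Real.sqrt κ)⁻¹ := by rw [Real.rpow_neg hκ0.le, hsqrt]
      rw [hinv] at hle
      have hsq0 : 0 < Real.sqrt κ := by linarith
      have ht1 : t < 1 := lt_of_le_of_lt hle (inv_lt_one_of_one_lt₀ hsqκ)
      refine ⟨ht1.ne, ?_⟩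
      -- `|t/(t−1)| = t/(1−t) ≤ (1/√κ)/(1 − 1/√κ) = 1/(√κ − 1) ≤ D`
      have hq : |t / (t - 1)| ≤ D := by
        rw [abs_div, abs_of_pos htpos, abs_of_neg (by linarith), neg_sub]
        have h1t : 0 < 1 - t := by linarith
        rw [div_le_iff₀ h1t, hD]
        -- `t ≤ 1/√κ` and `D (1 - t) ≥ D (1 − 1/√κ) = √κ/(√κ−1) · (√κ−1)/√κ = 1 ≥ t`
        have hle' : t * Real.sqrt κ ≤ 1 := by
          have := mul_le_mul_of_nonneg_right hle hsq0.le
          rwa [inv_mul_cancel₀ hsq0.ne'] at this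
        rw [div_mul_eq_mul_div, le_div_iff₀ (by linarith)]
        nlinarith
      have := pow_le_pow_left₀ (abs_nonneg _) hq 2
      rwa [sq_abs] at this


/-! ### Harnack's inequality at unit scale -/

/-- **MOSER'S HARNACK INEQUALITY at unit scale** (Moser 1961, Thm 1), `n ≥ 3`: there is `C_H ≥ 0` depending only on
`n, λ, Λ` such that every entire `C¹` weak solution `w ≥ 1` of `div(a∇w) = 0` (coefficients measurable, symmetric,
`λ|ξ|² ≤ ξ·aξ`, `|aᵢⱼ| ≤ Λ`; weak formulation of `Literature.Analysis.PDE.divFormLiouville`) satisfies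
`w(x) ≤ C_H · w(y)` for all `x, y ∈ B̄(0,1)`. -/
theorem harnack_unit (hn : 3 ≤ n) {lam : ℝ} (hlam : 0 < lam) (Λ : ℝ) :
    ∃ C_H : ℝ, 0 ≤ C_H ∧ ∀ (a : EuclideanSpace ℝ (Fin n) → Matrix (Fin n) (Fin n) ℝ),
      (∀ i j, Measurable fun y => a y i j) → (∀ y, (a y).IsSymm) →
      (∀ y (ξ : Fin n → ℝ), lam * (ξ ⬝ᵥ ξ) ≤ ξ ⬝ᵥ (a y *ᵥ ξ)) → (∀ y i j, |a y i j| ≤ Λ) →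
      ∀ (w : EuclideanSpace ℝ (Fin n) → ℝ), ContDiff ℝ 1 w → (∀ y, 1 ≤ w y) →
        (∀ η : EuclideanSpace ℝ (Fin n) → ℝ, ContDiff ℝ 1 η → HasCompactSupport η →
          ∫ y, ∑ i, ∑ j, a y i j * fderiv ℝ w y (EuclideanSpace.single i 1) *
            fderiv ℝ η y (EuclideanSpace.single j 1) = 0) →
        ∀ x ∈ closedBall (0 : EuclideanSpace ℝ (Fin n)) 1, ∀ y ∈ closedBall (0 : EuclideanSpace ℝ (Fin n)) 1,
          w x ≤ C_H * w y := by
  -- the exponents and constants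
  set κ : ℝ := n / (n - 2 : ℝ) with hκ
  have hn2 : (0 : ℝ) < n - 2 := by
    have : (3 : ℝ) ≤ n := by exact_mod_cast hn
    linarith
  have hκ1 : 1 < κ := by rw [hκ, lt_div_iff₀ hn2]; linarith
  have hκ0 : 0 < κ := zero_lt_one.trans hκ1
  obtain ⟨p₀, Ccr, hp₀, hCcr, hcross⟩ := exists_crossover n hlam Λ
  obtain ⟨C₀, hC₀0, hcut⟩ := exists_closedBall_cutoff n
  obtain ⟨p₁, hp₁, hp₁p₀, hch₁⟩ := exists_chain_exponent hκ1 hp₀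
  set C₁ : ℝ := C₀ + 1 with hC₁
  have hC₁pos : 0 < C₁ := by rw [hC₁]; linarith
  have hcut' : ∀ (x₀ : EuclideanSpace ℝ (Fin n)) (ρ' ρ : ℝ), 0 < ρ' → ρ' < ρ →
      ∃ χ : EuclideanSpace ℝ (Fin n) → ℝ, ContDiff ℝ 1 χ ∧ HasCompactSupport χ ∧ (∀ x, 0 ≤ χ x ∧ χ x ≤ 1) ∧
        (∀ x ∈ closedBall x₀ ρ', χ x = 1) ∧ (∀ x, x ∉ ball x₀ ρ → χ x = 0) ∧
        ∀ x, ‖fderiv ℝ χ x‖ ≤ C₁ / (ρ - ρ') := by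
    intro x₀ ρ' ρ hρ' hρ
    obtain ⟨χ, h1, h2, h3, h4, h5, h6⟩ := hcut x₀ ρ' ρ hρ' hρ
    refine ⟨χ, h1, h2, h3, h4, h5, fun x => (h6 x).trans ?_⟩
    exact div_le_div_of_nonneg_right (by rw [hC₁]; linarith) (by linarith)
  set D₁ : ℝ := (Real.sqrt κ / (Real.sqrt κ - 1)) ^ 2 with hD₁
  set CS : ℝ := (max (eLpNormLESNormFDerivOfEqInnerConst (volume : Measure (EuclideanSpace ℝ (Fin n))) 2 : ℝ) 1)
    with hCS
  -- the two Moser constants at `R = 1`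
  set Φp : ℝ≥0∞ := ENNReal.ofReal (CS ^ 2 * (2 * (D₁ * (n * Λ) + lam) / lam * (4 * C₁ ^ 2)) / 1 ^ 2) ^
      (κ / (p₁ * (κ - 1))) * (4 : ℝ≥0∞) ^ (κ / (p₁ * (κ - 1) ^ 2)) with hΦp
  set Φm : ℝ≥0∞ := ENNReal.ofReal (CS ^ 2 * (2 * (1 * (n * Λ) + lam) / lam * (4 * C₁ ^ 2)) / 1 ^ 2) ^
      (κ / (p₀ * (κ - 1))) * (4 : ℝ≥0∞) ^ (κ / (p₀ * (κ - 1) ^ 2)) with hΦm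
  set V₂ : ℝ≥0∞ := volume (closedBall (0 : EuclideanSpace ℝ (Fin n)) (2 * 1)) with hV₂
  set V₄ : ℝ≥0∞ := volume (ball (0 : EuclideanSpace ℝ (Fin n)) 4) with hV₄
  set Q : ℝ≥0∞ := Φp * Φm * V₂ ^ (1 / p₁ - 1 / p₀) * (ENNReal.ofReal Ccr * V₄ ^ 2) ^ (1 / p₀) with hQ
  have hκe1 : 0 ≤ κ / (p₁ * (κ - 1)) := by apply div_nonneg hκ0.le; nlinarith
  have hκe2 : 0 ≤ κ / (p₁ * (κ - 1) ^ 2) := by positivity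
  have hκe3 : 0 ≤ κ / (p₀ * (κ - 1)) := by apply div_nonneg hκ0.le; nlinarith
  have hκe4 : 0 ≤ κ / (p₀ * (κ - 1) ^ 2) := by positivity
  have he : 0 ≤ 1 / p₁ - 1 / p₀ := by
    rw [sub_nonneg]; exact one_div_le_one_div_of_le hp₁ hp₁p₀
  have hV₂top : V₂ ≠ ⊤ := measure_closedBall_lt_top.ne
  have hV₄top : V₄ ≠ ⊤ := measure_ball_lt_top.ne
  have hQtop : Q ≠ ⊤ := by
    rw [hQ]
    refine ENNReal.mul_ne_top (ENNReal.mul_ne_top (ENNReal.mul_ne_top ?_ ?_) ?_) ?_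
    · exact ENNReal.mul_ne_top (ENNReal.rpow_ne_top_of_nonneg hκe1 ENNReal.ofReal_ne_top)
        (ENNReal.rpow_ne_top_of_nonneg hκe2 ENNReal.ofNat_ne_top)
    · exact ENNReal.mul_ne_top (ENNReal.rpow_ne_top_of_nonneg hκe3 ENNReal.ofReal_ne_top)
        (ENNReal.rpow_ne_top_of_nonneg hκe4 ENNReal.ofNat_ne_top)
    · exact ENNReal.rpow_ne_top_of_nonneg he hV₂top
    · exact ENNReal.rpow_ne_top_of_nonneg (by positivity)
        (ENNReal.mul_ne_top ENNReal.ofReal_ne_top (ENNReal.pow_ne_top hV₄top))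
  refine ⟨Q.toReal, ENNReal.toReal_nonneg, fun a hmeas hsymm hell hbd w hw hw1 hweak x hx y hy => ?_⟩
  have hpos : ∀ z, 0 < w z := fun z => lt_of_lt_of_le one_pos (hw1 z)
  -- the sup chain (`σ = 1`, exponent `p₁`) and the inf chain (`σ = -1`, exponent `p₀`) at `R = 1`
  have hsup := moser_chain_sup hn hsymm hlam hmeas hell hbd hw hw1 hweak (σ := 1) (Or.inl rfl) hp₁ (D := D₁)
    (by positivity) (fun k => (hch₁ k).1) (fun k => (hch₁ k).2) hC₁pos hcut' 0 one_pos
  have hinf := moser_chain_sup hn hsymm hlam hmeas hell hbd hw hw1 hweak (σ := -1) (Or.inr rfl) hp₀ (D := 1)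
    zero_le_one (fun k => by nlinarith [show 0 < p₀ * κ ^ k by positivity])
    (fun k => by
      have hq : (-1 : ℝ) * (p₀ * κ ^ k) < 0 := by nlinarith [show 0 < p₀ * κ ^ k by positivity]
      set q : ℝ := -1 * (p₀ * κ ^ k)
      have h1 : 0 < q / (q - 1) := div_pos_of_neg_of_neg hq (by linarith)
      have h2 : q / (q - 1) ≤ 1 := by rw [div_le_one_of_neg (by linarith)]; linarith
      nlinarith)
    hC₁pos hcut' 0 one_pos
  -- Hölder on `B̄(0,2)`: from `p₁` to `p₀`
  have hmeasw : AEStronglyMeasurable (fun z => w z ^ (1 : ℝ)) (volume.restrict (closedBall (0 : EuclideanSpace ℝ (Fin n)) (2 * 1))) :=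
    (contDiff_rpow_of_one_le hw hw1 1).continuous.aestronglyMeasurable
  have hH := eLpNorm_le_eLpNorm_mul_rpow_measure_univ (ENNReal.ofReal_le_ofReal hp₁p₀) hmeasw
  rw [Measure.restrict_apply_univ, ENNReal.toReal_ofReal hp₁.le, ENNReal.toReal_ofReal hp₀.le] at hH
  -- the `L^{p₀}` norms as lintegrals, and the crossover on `B(0,4)`
  have hP : eLpNorm (fun z => w z ^ (1 : ℝ)) (ENNReal.ofReal p₀) (volume.restrict (closedBall 0 (2 * 1))) =
      (∫⁻ z in closedBall (0 : EuclideanSpace ℝ (Fin n)) (2 * 1), ENNReal.ofReal (w z ^ p₀)) ^ (1 / p₀) := by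
    rw [eLpNorm_rpow_eq _ hpos 1 hp₀]; simp only [one_mul]
  have hM : eLpNorm (fun z => w z ^ (-1 : ℝ)) (ENNReal.ofReal p₀) (volume.restrict (closedBall 0 (2 * 1))) =
      (∫⁻ z in closedBall (0 : EuclideanSpace ℝ (Fin n)) (2 * 1), ENNReal.ofReal (w z ^ (-p₀))) ^ (1 / p₀) := by
    rw [eLpNorm_rpow_eq _ hpos (-1) hp₀]; simp only [neg_one_mul]
  have hsub : closedBall (0 : EuclideanSpace ℝ (Fin n)) (2 * 1) ⊆ ball 0 4 :=
    closedBall_subset_ball (by norm_num)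
  have hcr := hcross a hmeas hsymm hell hbd w hw hw1 hweak 0 4 (by norm_num)
  have hPM : (∫⁻ z in closedBall (0 : EuclideanSpace ℝ (Fin n)) (2 * 1), ENNReal.ofReal (w z ^ p₀)) *
      (∫⁻ z in closedBall (0 : EuclideanSpace ℝ (Fin n)) (2 * 1), ENNReal.ofReal (w z ^ (-p₀))) ≤
      ENNReal.ofReal Ccr * V₄ ^ 2 :=
    (mul_le_mul' (lintegral_mono_set hsub) (lintegral_mono_set hsub)).trans hcr
  -- pointwise values
  have hxv : ENNReal.ofReal (w x) ≤ eLpNorm (fun z => w z ^ (1 : ℝ)) ∞ (volume.restrict (closedBall 0 1)) := by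
    have h := enorm_le_eLpNorm_top (contDiff_rpow_of_one_le hw hw1 1).continuous 0 one_pos hx
    rwa [Real.rpow_one, Real.enorm_eq_ofReal (hpos x).le] at h
  have hyv : ENNReal.ofReal ((w y)⁻¹) ≤ eLpNorm (fun z => w z ^ (-1 : ℝ)) ∞ (volume.restrict (closedBall 0 1)) := by
    have h := enorm_le_eLpNorm_top (contDiff_rpow_of_one_le hw hw1 (-1)).continuous 0 one_pos hy
    rwa [Real.rpow_neg_one, Real.enorm_eq_ofReal (inv_nonneg.2 (hpos y).le)] at h
  -- assemble in `ℝ≥0∞`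
  have hprod : ENNReal.ofReal (w x * (w y)⁻¹) ≤ Q := by
    rw [ENNReal.ofReal_mul (hpos x).le]
    refine (mul_le_mul' hxv hyv).trans ?_
    refine (mul_le_mul' hsup hinf).trans ?_
    refine (mul_le_mul' (mul_le_mul' le_rfl hH) le_rfl).trans ?_
    rw [hP, hM]
    set Pp := ∫⁻ z in closedBall (0 : EuclideanSpace ℝ (Fin n)) (2 * 1), ENNReal.ofReal (w z ^ p₀)
    set Pm := ∫⁻ z in closedBall (0 : EuclideanSpace ℝ (Fin n)) (2 * 1), ENNReal.ofReal (w z ^ (-p₀))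
    have hpm : Pp ^ (1 / p₀) * Pm ^ (1 / p₀) ≤ (ENNReal.ofReal Ccr * V₄ ^ 2) ^ (1 / p₀) := by
      rw [← ENNReal.mul_rpow_of_nonneg _ _ (by positivity)]
      exact ENNReal.rpow_le_rpow hPM (by positivity)
    calc Φp * (Pp ^ (1 / p₀) * V₂ ^ (1 / p₁ - 1 / p₀)) * (Φm * Pm ^ (1 / p₀))
        = Φp * Φm * V₂ ^ (1 / p₁ - 1 / p₀) * (Pp ^ (1 / p₀) * Pm ^ (1 / p₀)) := by ring
      _ ≤ Φp * Φm * V₂ ^ (1 / p₁ - 1 / p₀) * (ENNReal.ofReal Ccr * V₄ ^ 2) ^ (1 / p₀) := mul_le_mul' le_rfl hpm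
      _ = Q := by rw [hQ]
  have hreal : w x * (w y)⁻¹ ≤ Q.toReal := (ENNReal.ofReal_le_iff_le_toReal hQtop).1 hprod
  have := mul_le_mul_of_nonneg_right hreal (hpos y).le
  rwa [mul_assoc, inv_mul_cancel₀ (hpos y).ne', mul_one] at this

end Summit.NavierStokesRegularity.NavierStokesRegularity.Theorems.PoloidalWindowDoorPoloidalWindowRigidityDivFormHarnack

end
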